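import Literature.Geometry.Lorentzian.NearKerrLeaf
import Literature.Geometry.Lorentzian.CoordCurvature
import HarnessLib

/-!
# Crux `ClusterCompleteness.OmegaLimitMultiKerr` (stmt-FinalStateConjecture-14664) — TYPED HYPOTHESES of the
# Birkhoff re-line (line lead gen 6, cycle 6; crux WORKFILE for the planners, not a registered skeleton; no sorries)

Gen 4's `ReLineTameEra.lean` typed the recommended two-stub re-line with an abstract guard `Good`; gen 5
made the guard concrete as a physical TRANSFER INEQUALITY (P1) plus stationary RIGIDITY (P2); gen 6's
Birkhoff recurrence (`Theorems/…UniformRecurrence`, `…UniformRecurrenceStarHole`,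
`…JointUniformRecurrence`) lets (P1) be replaced by an ALMOST-PERIODIC RIGIDITY statement (P1′). This
file records (P1′) and (P2) as elaborating `Prop`s over landed vocabulary, in exactly the shape the
pointwise identification stub of the re-line would take them as named hypotheses (they are NOT
Literature facts: neither is in print — the periodic case of (P1′) is Bičák–Scholtz–Tod arXiv:1003.3402 /
Alexakis–Schlue arXiv:1504.04592; (P2) without analyticity or smallness is open). Hypotheses 1–5 of
(P1′) are what gens 3–6 PROVE for the `Cᵏ_loc` ω-limits `G = g + g_{M,a,Λ,c}` of tame anchored vacuum
star hole charts (regularity `…LimitRegularity`, metricity `…LimitIsMetric` — where the anchor beats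
the Kerr–Schild margin, gen 4 —, vacuum `…VacuumOmegaLimits`, anchor `…OmegaLimitGlue`, eternal bounds
`…LimitBounds`/`…EternalFamilies`), and hypothesis 6 is gen 6's uniform recurrence. With (P1′) ∧ (P2)
the pointwise chain closes over landed theorems: Birkhoff ⇒ almost-periodic dark limit ⇒ (P1′)
stationary ⇒ (P2) equal to the reference ⇒ zero dark limit along one (joint) sequence ⇒
`recurs_of_starCharts_of_omegaLimits_flat` / `…ZeroLimitsConverge` ⇒ `Recurs k`. What (P2) presupposes
— a RIGID era gauge and FINAL reference labels/motions — is generic content (see `Lines/Sketch.md`, gen 6,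
"select-and-rebase is closed as bookkeeping").
-/

set_option linter.dupNamespace false
noncomputable section
open Set Filter Topology Function
open scoped Manifold ContDiff Topology ENNReal
namespace Summit.FinalStateConjecture.FinalStateConjecture.Cruxes.OmegaLimitMultiKerr.ReLineBirkhoff
open Literature.Geometry.Lorentzian

/-- (P1′) typed: ALMOST-PERIODIC RIGIDITY of eternal vacuum ends in era gauge (per hole). A named
HYPOTHESIS for the pointwise stub of the re-line — not in print (Bičák–Scholtz–Tod arXiv:1003.3402 and
Alexakis–Schlue arXiv:1504.04592 prove the time-PERIODIC case near a complete 𝓘⁺). -/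
def AlmostPeriodicRigidity (k : ℕ) : Prop :=
  ∀ (Λ : lorentzGroup) (c : E4) (M a : ℝ), Kerr.IsSubextremal M a →
    ∀ (G : E4 → E4 →L[ℝ] E4 →L[ℝ] ℝ),
    let O : Set E4 := ((starBackground Λ c M a fun x ↦ Kerr.radius a (poincareInv Λ c x)).domain :
      Set E4)
    let e : E4 := (Λ : E4 ≃L[ℝ] E4) (EuclideanSpace.single (0 : Fin 4) (1 : ℝ))
    ContDiffOn ℝ (k + 2) G O →                                   -- regular (LimitRegularity)
    MetricCoord.IsMetricOn G O →                                  -- a chart metric (LimitIsMetric)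
    (∀ x ∈ O, MetricCoord.ricAt G x = 0) →                        -- vacuum (VacuumOmegaLimits)
    (∀ x ∈ O, ‖G x - boostedKerrBilin Λ c M a x‖ ≤ 1 / 4) →       -- anchored (OmegaLimitGlue)
    (∀ K ⊆ O, IsCompact K → ∃ C : ℝ, ∀ s : ℝ, ∀ i, i ≤ k + 2 →    -- tame, eternally (LimitBounds)
      ∀ z ∈ K, ‖iteratedFDeriv ℝ i G (z + s • e)‖ ≤ C) →
    (∀ K ⊆ O, IsCompact K → ∀ ε : ℝ, 0 < ε → ∃ L : ℝ, 0 < L ∧   -- almost periodic (UniformRecurrence)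
      ∀ t : ℝ, ∃ s ∈ Icc t (t + L),
        supCkENorm K k (fun x ↦ G (x + s • e) - G x) < ENNReal.ofReal ε) →
    ∀ x ∈ O, ∀ s : ℝ, G (x + s • e) = G x                         -- ⇒ stationary in era gauge

/-- (P2) typed: GAUGE-FIXED NO-HAIR in Kerr–Schild star charts (per hole): a stationary such `G`,
`1/4`-anchored to the reference, IS the reference. Open without analyticity (Carter–Robinson/Hawking)
or smallness (Alexakis–Ionescu–Klainerman 2010: `C²`-near-Kerr); as stated it presupposes that the
era gauge is rigid — part of what the GENERIC stub must deliver. -/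
def GaugeFixedNoHair (k : ℕ) : Prop :=
  ∀ (Λ : lorentzGroup) (c : E4) (M a : ℝ), Kerr.IsSubextremal M a →
    ∀ (G : E4 → E4 →L[ℝ] E4 →L[ℝ] ℝ),
    let O : Set E4 := ((starBackground Λ c M a fun x ↦ Kerr.radius a (poincareInv Λ c x)).domain :
      Set E4)
    let e : E4 := (Λ : E4 ≃L[ℝ] E4) (EuclideanSpace.single (0 : Fin 4) (1 : ℝ))
    ContDiffOn ℝ (k + 2) G O → MetricCoord.IsMetricOn G O → (∀ x ∈ O, MetricCoord.ricAt G x = 0) →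
    (∀ x ∈ O, ‖G x - boostedKerrBilin Λ c M a x‖ ≤ 1 / 4) →
    (∀ x ∈ O, ∀ s : ℝ, G (x + s • e) = G x) →
    ∀ x ∈ O, G x = boostedKerrBilin Λ c M a x

end Summit.FinalStateConjecture.FinalStateConjecture.Cruxes.OmegaLimitMultiKerr.ReLineBirkhoff
end
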